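import Literature.NumberTheory.Transcendental.SixExponentialsSeveralVariablesCor42Proofs
import Mathlib.Algebra.MvPolynomial.CommRing
import HarnessLib

/-!
# Integer-polynomial expressions in algebraic generators: degree/length bookkeeping and Liouville

Topic `Literature/NumberTheory/Transcendental`. Everything here is PROVED (one definition with a
body, no named facts). In the arithmetic half of a transcendence proof by Gel'fond–Schneider's
method one shows that the small numbers produced by the analysis (here: the jets along `W` of the
auxiliary function of [Waldschmidt1988, Prop. 6.1] at the points `exp_G(y_h)`, see
`LinearSubgroupTheoremAssembly.lean`) are values `Q(a)` of INTEGER polynomials `Q` at a fixed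
finite family `a` of algebraic numbers, with controlled total degree and length `∑|coeff|`, and
concludes by Liouville's inequality (the tree's `AlgGens.aeval_eq_zero_of_norm_lt`,
`SixExponentialsSeveralVariablesCor42Proofs.lean`). This file packages that bookkeeping once and
for all as a PREDICATE, so that the polynomial `Q` never has to be written down:

* `IntPolyBound a x e L` — "`x = Q(a)` for some `Q ∈ ℤ[Tᵢ]` of total degree `≤ e` and length
  `≤ L`";
* closure rules with the evident bookkeeping: generators (`1, 1`), integers (`0, |n|`),
  `mono`, `add`/`sub`/`neg` (`max e, L₁ + L₂`), `mul` (`e₁ + e₂, L₁ L₂` — via the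
  submultiplicativity of the length, `l1_mul_le`), `sum`, `prod`, `pow`, `intMul`;
* `IntPolyBound.eq_zero_of_norm_lt` — Liouville: if `x = Q(a)` with bounds `(e, L)`, `L ≥ 1`, and
  `|x| < ((|d|^e L M^e)^h)⁻¹` (`d, M, h` the denominator, conjugate bound and degree of `ℚ(a)`),
  then `x = 0`.

## References

* [Waldschmidt1988] M. Waldschmidt, *On the transcendence methods of Gel'fond and Schneider in
  several variables*, New Advances in Transcendence Theory, CUP 1988, §6 (p. 389).
* A. Baker, *Transcendental Number Theory*, CUP 1975, Ch. 2 Lemma 3 (Liouville's inequality).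
  [Baker1975]
-/

noncomputable section

open MvPolynomial Finset

namespace Literature.NumberTheory.Transcendental

section Length

variable {ι : Type*}

/-- The length `∑_s |coeff_s Q|` of an integer polynomial (as a real number). [folklore] -/
def zlen (Q : MvPolynomial ι ℤ) : ℝ := ∑ s ∈ Q.support, |((Q.coeff s : ℤ) : ℝ)|

/-- Unfolding. [folklore] -/
theorem zlen_def (Q : MvPolynomial ι ℤ) : zlen Q = ∑ s ∈ Q.support, |((Q.coeff s : ℤ) : ℝ)| := rfl

/-- `zlen Q ≥ 0`. [folklore] -/
theorem zlen_nonneg (Q : MvPolynomial ι ℤ) : 0 ≤ zlen Q :=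
  Finset.sum_nonneg fun _ _ => abs_nonneg _

/-- Subadditivity. [folklore] -/
theorem zlen_add_le (Q₁ Q₂ : MvPolynomial ι ℤ) : zlen (Q₁ + Q₂) ≤ zlen Q₁ + zlen Q₂ :=
  Waldschmidt1981.l1_add_le Q₁ Q₂

/-- Length of a monomial. [folklore] -/
theorem zlen_monomial_le (μ : ι →₀ ℕ) (c : ℤ) : zlen (monomial μ c) ≤ |(c : ℝ)| :=
  Waldschmidt1981.l1_monomial_le μ c

/-- `zlen (-Q) = zlen Q`. [folklore] -/
theorem zlen_neg (Q : MvPolynomial ι ℤ) : zlen (-Q) = zlen Q := by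
  rw [zlen, zlen, support_neg]
  exact Finset.sum_congr rfl fun s _ => by rw [coeff_neg]; push_cast; exact abs_neg _

/-- `zlen (∑ Qᵢ) ≤ ∑ zlen Qᵢ`. [folklore] -/
theorem zlen_sum_le {κ : Type*} (s : Finset κ) (f : κ → MvPolynomial ι ℤ) :
    zlen (∑ k ∈ s, f k) ≤ ∑ k ∈ s, zlen (f k) := by
  classical
  induction s using Finset.induction_on with
  | empty => simp [zlen]
  | insert a s ha ih =>
    rw [Finset.sum_insert ha, Finset.sum_insert ha]
    exact (zlen_add_le _ _).trans (add_le_add le_rfl ih)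

/-- **Submultiplicativity of the length**: `zlen (P Q) ≤ zlen P · zlen Q`. [folklore] -/
theorem zlen_mul_le [DecidableEq ι] (P Q : MvPolynomial ι ℤ) : zlen (P * Q) ≤ zlen P * zlen Q := by
  have hP : P = ∑ ν ∈ P.support, monomial ν (P.coeff ν) := P.as_sum
  have hQ : Q = ∑ μ ∈ Q.support, monomial μ (Q.coeff μ) := Q.as_sum
  have hPQ : P * Q = ∑ ν ∈ P.support, ∑ μ ∈ Q.support,
      monomial (ν + μ) (P.coeff ν * Q.coeff μ) := by
    have e : P * Q = (∑ ν ∈ P.support, monomial ν (P.coeff ν)) *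
        ∑ μ ∈ Q.support, monomial μ (Q.coeff μ) := by rw [← hP, ← hQ]
    rw [e, Finset.sum_mul]
    refine Finset.sum_congr rfl fun ν _ => ?_
    rw [Finset.mul_sum]
    exact Finset.sum_congr rfl fun μ _ => monomial_mul
  calc zlen (P * Q) = zlen (∑ ν ∈ P.support, ∑ μ ∈ Q.support,
        monomial (ν + μ) (P.coeff ν * Q.coeff μ)) := by rw [hPQ]
    _ ≤ ∑ ν ∈ P.support, ∑ μ ∈ Q.support, |((P.coeff ν * Q.coeff μ : ℤ) : ℝ)| := by
        refine (zlen_sum_le _ _).trans (Finset.sum_le_sum fun ν _ => ?_)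
        exact (zlen_sum_le _ _).trans (Finset.sum_le_sum fun μ _ => zlen_monomial_le _ _)
    _ = zlen P * zlen Q := by
        rw [zlen, zlen, Finset.sum_mul]
        refine Finset.sum_congr rfl fun ν _ => ?_
        rw [Finset.mul_sum]
        exact Finset.sum_congr rfl fun μ _ => by push_cast; exact abs_mul _ _

/-- `zlen 1 ≤ 1`. [folklore] -/
theorem zlen_one_le : zlen (1 : MvPolynomial ι ℤ) ≤ 1 := by
  have := zlen_monomial_le (ι := ι) 0 1
  simpa using this

/-- `zlen (∏ Qᵢ) ≤ ∏ zlen Qᵢ`. [folklore] -/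
theorem zlen_prod_le [DecidableEq ι] {κ : Type*} (s : Finset κ) (f : κ → MvPolynomial ι ℤ) :
    zlen (∏ k ∈ s, f k) ≤ ∏ k ∈ s, zlen (f k) := by
  classical
  induction s using Finset.induction_on with
  | empty => simpa using zlen_one_le (ι := ι)
  | insert a s ha ih =>
    rw [Finset.prod_insert ha, Finset.prod_insert ha]
    exact (zlen_mul_le _ _).trans (mul_le_mul_of_nonneg_left ih (zlen_nonneg _))

/-- `zlen (Q^k) ≤ (zlen Q)^k`. [folklore] -/
theorem zlen_pow_le [DecidableEq ι] (Q : MvPolynomial ι ℤ) (k : ℕ) : zlen (Q ^ k) ≤ zlen Q ^ k := by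
  induction k with
  | zero => simpa using zlen_one_le (ι := ι)
  | succ k ih =>
    rw [pow_succ, pow_succ]
    exact (zlen_mul_le _ _).trans (mul_le_mul_of_nonneg_right ih (zlen_nonneg _))

end Length

/-! ### The predicate -/

section Predicate

variable {ι : Type*} (a : ι → ℂ)

/-- **`x` is the value at `a` of an integer polynomial of total degree `≤ e` and length `≤ L`.**
[folklore] -/
def IntPolyBound (x : ℂ) (e : ℕ) (L : ℝ) : Prop :=
  ∃ Q : MvPolynomial ι ℤ, Q.totalDegree ≤ e ∧ zlen Q ≤ L ∧ MvPolynomial.aeval a Q = x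

variable {a}

namespace IntPolyBound

/-- Weakening the bounds. [folklore] -/
theorem mono {x : ℂ} {e e' : ℕ} {L L' : ℝ} (h : IntPolyBound a x e L) (he : e ≤ e') (hL : L ≤ L') :
    IntPolyBound a x e' L' := by
  obtain ⟨Q, h1, h2, h3⟩ := h
  exact ⟨Q, h1.trans he, h2.trans hL, h3⟩

/-- The bound `L` is nonnegative. [folklore] -/
theorem nonneg {x : ℂ} {e : ℕ} {L : ℝ} (h : IntPolyBound a x e L) : 0 ≤ L := by
  obtain ⟨Q, -, h2, -⟩ := h
  exact (zlen_nonneg Q).trans h2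

/-- A generator: `aᵢ = Tᵢ(a)`. [folklore] -/
theorem gen (i : ι) : IntPolyBound a (a i) 1 1 := by
  classical
  refine ⟨X i, ?_, ?_, by simp⟩
  · rw [totalDegree_X]
  · have h := zlen_monomial_le (ι := ι) (Finsupp.single i 1) 1
    rw [Int.cast_one, abs_one] at h
    exact h

/-- An integer. [folklore] -/
theorem intCast (n : ℤ) : IntPolyBound a (n : ℂ) 0 |(n : ℝ)| := by
  refine ⟨C n, by rw [totalDegree_C], ?_, by simp⟩
  have := zlen_monomial_le (ι := ι) 0 n
  rwa [monomial_zero'] at this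

/-- A natural number. [folklore] -/
theorem natCast (n : ℕ) : IntPolyBound a (n : ℂ) 0 (n : ℝ) := by
  have := intCast (a := a) (n : ℤ)
  rw [Int.cast_natCast] at this
  simpa using this

/-- Sum. [folklore] -/
theorem add {x y : ℂ} {e₁ e₂ : ℕ} {L₁ L₂ : ℝ} (hx : IntPolyBound a x e₁ L₁) (hy : IntPolyBound a y e₂ L₂) :
    IntPolyBound a (x + y) (max e₁ e₂) (L₁ + L₂) := by
  obtain ⟨Q₁, h1, h2, rfl⟩ := hx
  obtain ⟨Q₂, h1', h2', rfl⟩ := hy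
  refine ⟨Q₁ + Q₂, (totalDegree_add _ _).trans (max_le_max h1 h1'), ?_, by simp⟩
  exact (zlen_add_le _ _).trans (add_le_add h2 h2')

/-- Negation. [folklore] -/
theorem neg {x : ℂ} {e : ℕ} {L : ℝ} (hx : IntPolyBound a x e L) : IntPolyBound a (-x) e L := by
  obtain ⟨Q, h1, h2, rfl⟩ := hx
  exact ⟨-Q, by rwa [totalDegree_neg], by rwa [zlen_neg], by simp⟩

/-- Difference. [folklore] -/
theorem sub {x y : ℂ} {e₁ e₂ : ℕ} {L₁ L₂ : ℝ} (hx : IntPolyBound a x e₁ L₁) (hy : IntPolyBound a y e₂ L₂) :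
    IntPolyBound a (x - y) (max e₁ e₂) (L₁ + L₂) := by
  rw [sub_eq_add_neg]
  exact hx.add hy.neg

/-- Product. [folklore] -/
theorem mul {x y : ℂ} {e₁ e₂ : ℕ} {L₁ L₂ : ℝ} (hx : IntPolyBound a x e₁ L₁) (hy : IntPolyBound a y e₂ L₂) :
    IntPolyBound a (x * y) (e₁ + e₂) (L₁ * L₂) := by
  classical
  obtain ⟨Q₁, h1, h2, rfl⟩ := hx
  obtain ⟨Q₂, h1', h2', rfl⟩ := hy
  refine ⟨Q₁ * Q₂, (totalDegree_mul _ _).trans (add_le_add h1 h1'), ?_, by simp⟩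
  exact (zlen_mul_le _ _).trans (mul_le_mul h2 h2' (zlen_nonneg _) ((zlen_nonneg _).trans h2))

/-- Integer multiple. [folklore] -/
theorem intMul {x : ℂ} {e : ℕ} {L : ℝ} (n : ℤ) (hx : IntPolyBound a x e L) :
    IntPolyBound a ((n : ℂ) * x) e (|(n : ℝ)| * L) := by
  have h := (intCast (a := a) n).mul hx
  rwa [zero_add] at h

/-- Finite sum (common degree bound). [folklore] -/
theorem sum {κ : Type*} (s : Finset κ) {x : κ → ℂ} {e : ℕ} {L : κ → ℝ}
    (h : ∀ k ∈ s, IntPolyBound a (x k) e (L k)) :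
    IntPolyBound a (∑ k ∈ s, x k) e (∑ k ∈ s, L k) := by
  classical
  induction s using Finset.induction_on with
  | empty =>
    refine ⟨0, by simp, by simp [zlen], by simp⟩
  | insert b s hb ih =>
    rw [Finset.sum_insert hb, Finset.sum_insert hb]
    have h1 := h b (Finset.mem_insert_self b s)
    have h2 := ih fun k hk => h k (Finset.mem_insert_of_mem hk)
    have := h1.add h2
    rwa [max_self] at this

/-- Finite product. [folklore] -/
theorem prod {κ : Type*} (s : Finset κ) {x : κ → ℂ} {e : κ → ℕ} {L : κ → ℝ}
    (h : ∀ k ∈ s, IntPolyBound a (x k) (e k) (L k)) :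
    IntPolyBound a (∏ k ∈ s, x k) (∑ k ∈ s, e k) (∏ k ∈ s, L k) := by
  classical
  induction s using Finset.induction_on with
  | empty =>
    refine ⟨1, by simp, ?_, by simp⟩
    simpa using zlen_one_le (ι := ι)
  | insert b s hb ih =>
    rw [Finset.prod_insert hb, Finset.sum_insert hb, Finset.prod_insert hb]
    exact (h b (Finset.mem_insert_self b s)).mul (ih fun k hk => h k (Finset.mem_insert_of_mem hk))

/-- Power. [folklore] -/
theorem pow {x : ℂ} {e : ℕ} {L : ℝ} (hx : IntPolyBound a x e L) (k : ℕ) :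
    IntPolyBound a (x ^ k) (k * e) (L ^ k) := by
  have h := prod (a := a) (Finset.range k) (x := fun _ => x) (e := fun _ => e) (L := fun _ => L)
    fun _ _ => hx
  simpa using h

/-- **Liouville.** For the generators of an `AlgGens` (a finite family of algebraic numbers with
number field `K = ℚ(a)`, denominator `d`, conjugate bound `M`, degree `h`): a value `x = Q(a)`
with bounds `(e, L)`, `L ≥ 1`, and `|x| < ((|d|^e L M^e)^h)⁻¹` vanishes.
[cite: Baker1975, Ch. 2 Lemma 3] -/
theorem eq_zero_of_norm_lt (G : AlgGens) {x : ℂ} {e : ℕ} {L : ℝ} (hx : IntPolyBound G.a x e L)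
    (hL1 : 1 ≤ L) (hlt : ‖x‖ < ((|(G.den : ℝ)| ^ e * L * G.M ^ e) ^ G.h)⁻¹) : x = 0 := by
  obtain ⟨Q, he, hL, rfl⟩ := hx
  exact G.aeval_eq_zero_of_norm_lt Q he hL hL1 hlt

end IntPolyBound

end Predicate

end Literature.NumberTheory.Transcendental
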